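/-
Copyright (c) 2026 the pub-hodgecm-mathlib formalisation cell (harness21).  Prover seat hodgecm-mathlib-K2E3-p20 (g2),
Track B «K2-LIT» ∕ h413, line `K2_E3_EllipticInputs`, unit U5Kazhdan ∕ annex U5bWildPlancherel, socket #20P (DISC-PL) — rung (R-c): (DISC-PL)'s `d` IS
Kottwitz's Euler–Poincaré value on the Steinberg classes `St_G(ψ)`.  Dealer K2E3-plan (g1) 23:09:36Z (d) «K2E3-p20 (g2) ↦ (R-c) CONFIRMED».  2026-09-03.
-/
import Summits.HodgeConjecture.HodgeConjecture.Theorems.K2E3PseudoCoeffExistsEllipticEPAllPlaces   -- ★ p855090 (K2E3-p17): `exists_epFunction_G_all`; brings ★ p855014 `char_stG_eq_neg_char_detG_of_jh`, ★ FILE B `isPseudoCoeff_stG_of_ep`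
import Summits.HodgeConjecture.HodgeConjecture.Theorems.K2E3PseudoCoeffValueAtOneL2OfPlancherel     -- ★ p854982 (K2E3-p20 g0) §1: `apply_one_eq_formalDegree_of_hasSum` («f 1 = d π» from a one-column trace table)
import Summits.HodgeConjecture.HodgeConjecture.Theorems.F0P3cStCharTSEPGlueGExplicit                -- ★ (G3)-EXPLICIT (LH10-p02): `epFunction_G_explicit` — Kottwitz's `f_G = ν(K₀)⁻¹𝟙_{K₀} + ν(K₁)⁻¹𝟙_{K₁} − ν(I)⁻¹𝟙_I` displayed
import HarnessLib

/-!
# K2_E3 road (h413 = stmt-HodgeConjecture-24833), socket #20P «DISC-PL» — rung (R-c): ANY `d` SATISFYING (DISC-PL) IS KOTTWITZ'S EULER–POINCARÉ VALUE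
# ON THE STEINBERG CLASSES: `d(St_G(ψ)) = −f_EP(1)` (`= ν(I)⁻¹ − ν(K₀)⁻¹ − ν(K₁)⁻¹` at an unramified place)

Cell `pub/hodgecm-mathlib` (D-0151), Track B, line `Summits/HodgeConjecture/HodgeConjecture/Cruxes/H413/Lines/K2_E3_EllipticInputs.lean`, unit U5Kazhdan,
socket #20P `sig_K2E3DiscretePlancherelCuspidal` (annex `…Sigs_U5bWildPlancherel.lean` :144; MEMO-20P-road 6ab33264ff32dae1 §4 (R-c); dealer K2E3-plan (g1)
ONE-WORD RULINGS 23:09:36Z (d)).  Helper file (`--supports stmt-HodgeConjecture-24833 --as helper`, no socket closed); THEOREMS ONLY; `𝔇` a BINDER; ★-only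
imports; the twin, on the Steinberg classes, of ★ p855447 `K2E3DiscretePlancherelPinsFormalDegree` (which pins `d` on the supercuspidal classes).

THE MATHEMATICS [Rogawski1990 p. 194 «By the Plancherel formula, `f_π(1) = d(π)`»; Kottwitz1988 §2].  Socket #20P posits `∃ d > 0` with
`f(1) = Σ_{σ ∈ E₂(G)} d(σ) Tr σ(f)` for every CUSPIDAL test function `f` on `G = U(Φ₃)(L⁺_v)`.  Kottwitz's Euler–Poincaré function `f_G` (by SHAPE: locally constant,
compactly supported, `f_G(1)` real negative, canonical orbital integral `1` at the elliptic regular classes and `0` at the hyperbolic ones — ★ at EVERY non-split place,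
`exists_epFunction_G_all`) gives the pseudo-coefficient `f_{St} := −\overline{ψ(det_G ·)}·f_G` of `St_G(ψ)` (★ FILE B `isPseudoCoeff_stG_of_ep`, the opposite-character
letter `χ_{St_G(ψ)} = −χ_{ψ∘det_G}` on `G^e` supplied by ★ `char_stG_eq_neg_char_detG_of_jh` from the kind-2 JH letter), a cuspidal function with `f_{St}(1) = −f_G(1) > 0`
(§1).  With the trace identity «`Tr σ(f_π) = ⟨χ_σ, χ_π⟩_e`» (★ carpet `Ch12Sec6.PseudoCoeffTrace`, in house at the pins ★ p855132) and the `St_G(ψ)`-COLUMN of the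
orthonormality relations (`⟨χ_σ, χ_{St_G(ψ)}⟩_e = [σ = St_G(ψ)]` on the `L²` classes — the consequent of socket #15 `sig_K2E3KazhdanL2Orthonormal` BY SHAPE, one
column; its diagonal entry is ★ K2′ `innerG_char_stG_self_eq_one_of_mass`) the Plancherel series of `f_{St}` has ONE term, so every `d` satisfying (DISC-PL) has
`d(St_G(ψ)) = f_{St}(1) = −f_G(1)` (§2) — at an unramified place, with Kottwitz's function displayed (★ (G3)-EXPLICIT), `d(St_G(ψ)) = ν(I)⁻¹ − ν(K₀)⁻¹ − ν(K₁)⁻¹`,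
the Euler–Poincaré expression of the formal degree of the Steinberg representation (§3) [Kottwitz1988 §2; cf. Borel 1976 §5 for `d(St)`].  So #20P's `∃ d` carries no
junk freedom on the kind-2 square-integrable classes either, and (DISC-PL) ⊕ PCT ⊕ the `St`-column FORCES the positivity `0 < d(St_G(ψ))` that #20P's first conjunct
asks (§2, last clause) — the O3 letter «formal degrees» of ★ `F0P3cStCharTSRung0TwentyTwo` read at its Steinberg member.
* §1 `epSt_apply_one` — `f_{St}(1) = −f_G(1)` (`det_Z 1 = 1`, `ψ 1 = 1`).
* §2 **`discretePlancherel_pins_formalDegree_stG`** (letters `detZ hopen hdet ψ₀ hψ₀ hne hJH` explicit, EP function `fG` by shape explicit),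
  **`discretePlancherel_pins_formalDegree_stG_of_eSt`** (every continuous `ψ`, letters from the socket's pin `eSt` VERBATIM and hC03; EP function from ★ `exists_epFunction_G_all`).
* §3 **`discretePlancherel_formalDegree_stG_kottwitz`** — unramified `v`: `d(St_G(ψ)) = ν(I)⁻¹ − ν(K₀)⁻¹ − ν(K₁)⁻¹` for Kottwitz's displayed `f_G` (★ `epFunction_G_explicit`).
HONEST LABEL: count-neutral; HC_CM is proved only modulo the 7 printed citations (2 remaining named inputs: hLiu418 = stmt-HodgeConjecture-24832, h413 =
stmt-HodgeConjecture-24833) until rung 0 closes; this `--supports` helper retires nothing by itself (its trace inputs `hPCT`, `hOrthoSt` are hypotheses BY SHAPE).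

## References
* [Rogawski1990] J. D. Rogawski, *Automorphic Representations of Unitary Groups in Three Variables*, Ann. of Math. Stud. 123 (1990), §12.6 p. 187, Prop. 12.6.1
  (a)(c) p. 188; §12.7 Lemma 12.7.2 (proof) p. 194; §12.2 (1) p. 173.
* [Kottwitz1988] R. E. Kottwitz, *Tamagawa numbers*, Ann. of Math. 127 (1988), §2 Theorem 2 (Euler–Poincaré functions).
* [Waldspurger2003] J.-L. Waldspurger, *La formule de Plancherel pour les groupes p-adiques (d'après Harish-Chandra)*, J. Inst. Math. Jussieu 2 (2003).
-/

set_option autoImplicit false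
-- the mandated namespace has the single-problem summit's repeated segment (`HodgeConjecture.HodgeConjecture`)
set_option linter.dupNamespace false

noncomputable section

open NumberField IsDedekindDomain MeasureTheory Filter Topology
open scoped Matrix MatrixGroups Valued ComplexConjugate
open Literature.NumberTheory.Rogawski1990 Literature.NumberTheory.Rogawski1990.Ch12Sec5
open Literature.NumberTheory.Automorphic Literature.NumberTheory.Automorphic.UnitaryGroup
open Literature.NumberTheory.GaloisRepresentations

namespace Summit.HodgeConjecture.HodgeConjecture.Cruxes.H413.K2E3DiscretePlancherelPinsSteinberg

open Summit.HodgeConjecture.HodgeConjecture.Cruxes.H413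
open Summit.HodgeConjecture.HodgeConjecture.Cruxes.H413.F0P3cStCharTSTorusDefs
open Summit.HodgeConjecture.HodgeConjecture.Cruxes.H413.F0P3cStCharTSEPPseudoCoeffSt (isPseudoCoeff_stG_of_ep)
open Summit.HodgeConjecture.HodgeConjecture.Cruxes.H413.K2E3PseudoCoeffExistsEllipticStDetOfEP (char_stG_eq_neg_char_detG_of_jh)
open Summit.HodgeConjecture.HodgeConjecture.Cruxes.H413.K2E3PseudoCoeffExistsEllipticEPAllPlaces (exists_epFunction_G_all)
open Summit.HodgeConjecture.HodgeConjecture.Cruxes.H413.K2E3PseudoCoeffValueAtOneL2OfPlancherel (apply_one_eq_formalDegree_of_hasSum)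
open Summit.HodgeConjecture.HodgeConjecture.Cruxes.H413.F0P3cStCharTSEPGlueGExplicit (epFunction_G_explicit)

/-! ## §1 The value at `1` of the Euler–Poincaré pseudo-coefficient of `St_G(ψ)` -/

/-- **`f_{St}(1) = −f_G(1)`** for `f_{St} = −\overline{ψ(det_Z ·)}·f_G` (the pseudo-coefficient of `St_G(ψ)` of ★ FILE B `isPseudoCoeff_stG_of_ep`): `det_Z 1 = 1` and
`ψ 1 = 1`. [cite: Kottwitz1988, §2 Theorem 2] -/
theorem epSt_apply_one {G Z : Type*} [Group G] [Group Z] (ψ : Z →* ℂˣ) (detZ : G →* Z) (fG : G → ℂ) :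
    (fun g : G => -(conj (((ψ (detZ g)) : ℂˣ) : ℂ) * fG g)) 1 = -fG 1 := by
  simp only [map_one, Units.val_one, map_one, one_mul]

section CM

variable (L : Type) [Field L] [NumberField L] [IsCMField L] (v : HeightOneSpectrum (𝓞 ↥(maximalRealSubfield L)))

/-! ## §2 At the organ's datum on `U(Φ₃)(L⁺_v)`: (DISC-PL)'s `d` is `−f_G(1)` on every Steinberg class -/

set_option maxHeartbeats 1600000 in
set_option synthInstance.maxHeartbeats 400000 in
-- statement-level instance-term unification on the CM local carriers (as ★ p855014 ∕ ★ p855447, same frame)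
open scoped Classical in
/-- **(DISC-PL) PINS `d` ON A STEINBERG CLASS: `d(St_G(ψ)) = −f_G(1)`.**  At a §12.5 datum `𝔇` on `G = U(Φ₃)(L⁺_v)` (`v` non-split) with the rung-0 pins hC01
`hC01`, hC04, hC05, `hE`, (M1∀) `hchar`, a canonical orbital family (`hcanQ`); the character `ψ` of the centre with its DET pin (`detZ hopen hdet`) and kind-2
JH letter (`ψ₀ hψ₀ hne hJH`) — the letters of the organ's pin `eSt`; an Euler–Poincaré function `fG` BY SHAPE (`hfG hre h1 h0` — the clauses used; ★ `exists_epFunction_G_all` at every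
place); `St_G(ψ)` square-integrable (`hL2`, pin `hStL2`); the trace identity `hPCT` (★ carpet `PseudoCoeffTrace`, ★ p855132 at the pins) and the `St_G(ψ)`-column
`hOrthoSt` of the orthonormality relations (socket #15's consequent BY SHAPE).  THEN every `d : IrrClass G → ℝ` whose Plancherel series over the `L²` classes sums to
`f(1)` at every cuspidal test function `f` (the consequent of socket #20P) satisfies `d(St_G(ψ)) = −f_G(1)` (as complex and as real numbers) and `0 < d(St_G(ψ))`.
[cite: Rogawski1990, §12.7 Lemma 12.7.2 (proof) p. 194; §12.6 p. 187, Prop. 12.6.1 (a)(c) p. 188] [cite: Kottwitz1988, §2 Theorem 2] [cite: Waldspurger2003, formule de Plancherel] -/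
theorem discretePlancherel_pins_formalDegree_stG
    (hns : ∀ w : PlacesOver L v, IsCMField.complexConj L • w.1 = w.1)
    [MeasurableSpace (Gqs L v)] [BorelSpace (Gqs L v)]
    [∀ γ : Gqs L v, MeasurableSpace (Gqs L v ⧸ Subgroup.centralizer ({γ} : Set (Gqs L v)))]
    [∀ γ : Gqs L v, BorelSpace (Gqs L v ⧸ Subgroup.centralizer ({γ} : Set (Gqs L v)))]
    [MeasurableSpace (Gqs L v ⧸ Subgroup.center (Gqs L v))]
    {H : Type} [Group H] [TopologicalSpace H] [IsTopologicalGroup H] [MeasurableSpace H]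
    (νQv : Measure (Gqs L v)) [νQv.IsHaarMeasure] [νQv.IsMulRightInvariant] (mQv : OrbitalMeasureFamily (Gqs L v))
    (hcanQ : mQv.IsCanonical (fun γ => IsRegularElt (γ.val : GL (Fin 3) (UnitaryGroup.LocalRing L v))) νQv)
    (𝔇 : EllipticData (Gqs L v) H) (hC01 : 𝔇.μG = νQv) (hC04 : 𝔇.orb = mQv)
    (hC05 : ∀ γ : Gqs L v, γ ∈ 𝔇.regG ↔ IsRegularElt (γ.val : GL (Fin 3) (UnitaryGroup.LocalRing L v)))
    (hE : ∀ γ : Gqs L v, γ ∈ 𝔇.ellG ↔ IsRegularElt (γ.val : GL (Fin 3) (UnitaryGroup.LocalRing L v)) ∧ γ ∉ hyperbolicSet L v)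
    (hchar : ∀ π : IrrClass (Gqs L v), Measurable (𝔇.char π) ∧ LocallyIntegrable (𝔇.char π) 𝔇.μG ∧
      (∀ x ∈ 𝔇.regG, ∀ᶠ y in 𝓝 x, 𝔇.char π y = 𝔇.char π x) ∧
      ∀ φ : Gqs L v → ℂ, IsLocSmooth φ → π.smoothTrace 𝔇.μG φ = ∫ x, φ x * 𝔇.char π x ∂𝔇.μG)
    -- ══ the character `ψ` of the centre, its DET pin and its kind-2 JH letter (letters of the pin `eSt`) ══
    {ψ : ↥(Subgroup.center (Gqs L v)) →* ℂˣ} (detZ : Gqs L v →* ↥(Subgroup.center (Gqs L v)))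
    (hopen : IsOpen (((ψ.comp detZ).ker : Subgroup (Gqs L v)) : Set (Gqs L v)))
    (hdet : 𝔇.detG ψ = IrrClass.mk (SmoothIrrep.ofChar (ψ.comp detZ) hopen))
    (ψ₀ : ↥(normOneUnits (conjLocal L (IsCMField.complexConj L) v)) →* ℂˣ) (hψ₀ : Continuous ψ₀)
    (hne : 𝔇.stG ψ ≠ 𝔇.detG ψ)
    (hJH : ∀ c : IrrClass (Gqs L v),
      c.IsConstituentOf (cmPrincipalSeries L 3 v (cmTorusCharPair L v
        (halfModulusChar (UnitaryGroup.LocalRing L v) * halfModulusChar (UnitaryGroup.LocalRing L v))⁻¹ ψ₀)) ↔ (c = 𝔇.stG ψ ∨ c = 𝔇.detG ψ))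
    -- ══ an Euler–Poincaré function BY SHAPE (the clauses used; ★ `exists_epFunction_G_all`) ══
    {fG : Gqs L v → ℂ} (hfG : IsLocSmooth fG) (hre : (fG 1).re < 0)
    (h1 : ∀ γ : Gqs L v, IsRegularElt (γ.val : GL (Fin 3) (UnitaryGroup.LocalRing L v)) →
      IsCompact ((Subgroup.centralizer ({γ} : Set (Gqs L v))) : Set (Gqs L v)) → classOrbitalIntegral mQv fG (ConjClasses.mk γ) = 1)
    (h0 : ∀ γ : Gqs L v, IsRegularElt (γ.val : GL (Fin 3) (UnitaryGroup.LocalRing L v)) →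
      ¬ IsCompact ((Subgroup.centralizer ({γ} : Set (Gqs L v))) : Set (Gqs L v)) → classOrbitalIntegral mQv fG (ConjClasses.mk γ) = 0)
    -- ══ `St_G(ψ)` is square-integrable (pin `hStL2`) ══
    (hL2 : 𝔇.IsL2 (𝔇.stG ψ))
    -- ══ the trace identity and the `St_G(ψ)`-column of the orthonormality relations ══
    (hPCT : Ch12Sec6.PseudoCoeffTrace 𝔇)
    (hOrthoSt : ∀ σ : IrrClass (Gqs L v), 𝔇.IsL2 σ → 𝔇.innerG (𝔇.char σ) (𝔇.char (𝔇.stG ψ)) = if σ = 𝔇.stG ψ then 1 else 0)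
    -- ══ a `d` satisfying the consequent of socket #20P ══
    (d : IrrClass (Gqs L v) → ℝ)
    (hPL : ∀ f : Gqs L v → ℂ, f ∈ SchwartzBruhat (Gqs L v) → (∀ γ ∈ 𝔇.regG \ 𝔇.ellG, 𝔇.orbInt γ f = 0) →
      HasSum (fun σ : {σ : IrrClass (Gqs L v) // 𝔇.IsL2 σ} => ((d (σ : IrrClass (Gqs L v)) : ℝ) : ℂ) * (σ : IrrClass (Gqs L v)).smoothTrace 𝔇.μG f) (f 1)) :
    ((d (𝔇.stG ψ) : ℝ) : ℂ) = -fG 1 ∧ d (𝔇.stG ψ) = -(fG 1).re ∧ 0 < d (𝔇.stG ψ) := by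
  -- the Euler–Poincaré pseudo-coefficient of `St_G(ψ)`
  have hOpp : ∀ γ ∈ 𝔇.ellG, 𝔇.char (𝔇.stG ψ) γ = -𝔇.char (𝔇.detG ψ) γ :=
    char_stG_eq_neg_char_detG_of_jh L v hns νQv mQv hcanQ 𝔇 hC01 hC05 hE hchar ψ₀ hψ₀ hne hJH
  have hf : 𝔇.IsPseudoCoeff (𝔇.stG ψ) (fun g => -(conj (((ψ (detZ g)) : ℂˣ) : ℂ) * fG g)) :=
    isPseudoCoeff_stG_of_ep L v hns νQv mQv 𝔇 hC01 hC04 hC05 hE hchar detZ hopen hdet hOpp hfG h1 h0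
  -- its Plancherel series has the single term `d(St_G(ψ))`
  have hval : (fun g => -(conj (((ψ (detZ g)) : ℂˣ) : ℂ) * fG g)) 1 = ((d (𝔇.stG ψ) : ℝ) : ℂ) :=
    apply_one_eq_formalDegree_of_hasSum 𝔇 d (fun σ _ => hPCT (𝔇.stG ψ) σ _ hf) hOrthoSt (hPL _ hf.1 hf.2.1) hL2
  rw [epSt_apply_one] at hval
  have hC : ((d (𝔇.stG ψ) : ℝ) : ℂ) = -fG 1 := hval.symm
  have hR : d (𝔇.stG ψ) = -(fG 1).re := by
    have := congrArg Complex.re hC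
    simpa using this
  exact ⟨hC, hR, by rw [hR]; linarith⟩

set_option maxHeartbeats 1600000 in
set_option synthInstance.maxHeartbeats 400000 in
-- statement-level instance-term unification on the CM local carriers (as §2's first theorem)
open scoped Classical in
/-- **(DISC-PL) PINS `d` ON EVERY STEINBERG CLASS, LETTERS FROM THE PIN `eSt`.**  Binders: the socket's `hns νQv mQv hcanQ μZ 𝔇`, pins hC01 hC03 hC04 hC05
`hE` `hchar` and the last pin `eSt` VERBATIM; the trace identity `hPCT` and, for the given continuous `ψ`, the `St_G(ψ)`-column `hOrthoSt` of socket #15's consequent;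
a `d` satisfying socket #20P's consequent (`hPL`).  THEN there is an Euler–Poincaré function `f_G` by shape at `v` (★ `exists_epFunction_G_all`: unramified (G3), tame
(G3)-RAM, wild socket #21 ★) and for EVERY such function `d(St_G(ψ)) = −f_G(1) > 0`. [cite: Rogawski1990, §12.7 Lemma 12.7.2 (proof) p. 194; §12.2 (1) p. 173]
[cite: Kottwitz1988, §2 Theorem 2] [cite: Waldspurger2003, formule de Plancherel] -/
theorem discretePlancherel_pins_formalDegree_stG_of_eSt
    (hns : ∀ w : PlacesOver L v, IsCMField.complexConj L • w.1 = w.1)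
    [MeasurableSpace (Gqs L v)] [BorelSpace (Gqs L v)]
    [∀ γ : Gqs L v, MeasurableSpace (Gqs L v ⧸ Subgroup.centralizer ({γ} : Set (Gqs L v)))]
    [∀ γ : Gqs L v, BorelSpace (Gqs L v ⧸ Subgroup.centralizer ({γ} : Set (Gqs L v)))]
    [MeasurableSpace (Gqs L v ⧸ Subgroup.center (Gqs L v))]
    {H : Type} [Group H] [TopologicalSpace H] [IsTopologicalGroup H] [MeasurableSpace H]
    (νQv : Measure (Gqs L v)) [νQv.IsHaarMeasure] [νQv.IsMulRightInvariant] (mQv : OrbitalMeasureFamily (Gqs L v))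
    (hcanQ : mQv.IsCanonical (fun γ => IsRegularElt (γ.val : GL (Fin 3) (UnitaryGroup.LocalRing L v))) νQv)
    (μZ : Measure (Gqs L v ⧸ Subgroup.center (Gqs L v)))
    (𝔇 : EllipticData (Gqs L v) H) (hC01 : 𝔇.μG = νQv) (hC03 : 𝔇.μGZ = μZ) (hC04 : 𝔇.orb = mQv)
    (hC05 : ∀ γ : Gqs L v, γ ∈ 𝔇.regG ↔ IsRegularElt (γ.val : GL (Fin 3) (UnitaryGroup.LocalRing L v)))
    (hE : ∀ γ : Gqs L v, γ ∈ 𝔇.ellG ↔ IsRegularElt (γ.val : GL (Fin 3) (UnitaryGroup.LocalRing L v)) ∧ γ ∉ hyperbolicSet L v)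
    (hchar : ∀ π : IrrClass (Gqs L v), Measurable (𝔇.char π) ∧ LocallyIntegrable (𝔇.char π) 𝔇.μG ∧
      (∀ x ∈ 𝔇.regG, ∀ᶠ y in 𝓝 x, 𝔇.char π y = 𝔇.char π x) ∧
      ∀ φ : Gqs L v → ℂ, IsLocSmooth φ → π.smoothTrace 𝔇.μG φ = ∫ x, φ x * 𝔇.char π x ∂𝔇.μG)
    -- ══ the socket's pin `eSt`, VERBATIM ══
    (eSt : ∃ (ιZ : ↥(normOneUnits (conjLocal L (IsCMField.complexConj L) v)) →* ↥(Subgroup.center (Gqs L v))) (detZ : (Gqs L v) →* ↥(Subgroup.center (Gqs L v))), Continuous ιZ ∧ Continuous detZ ∧ (∀ z : ↥(normOneUnits (conjLocal L (IsCMField.complexConj L) v)), ((ιZ z).val.val.val : Matrix (Fin 3) (Fin 3) (UnitaryGroup.LocalRing L v)) = (((z : (UnitaryGroup.LocalRing L v)ˣ) : UnitaryGroup.LocalRing L v)) • (1 : Matrix (Fin 3) (Fin 3) (UnitaryGroup.LocalRing L v))) ∧ (∀ g : (Gqs L v), ((detZ g).val.val.val : Matrix (Fin 3) (Fin 3) (UnitaryGroup.LocalRing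 L v)) = (g.val.val : Matrix (Fin 3) (Fin 3) (UnitaryGroup.LocalRing L v)).det • (1 : Matrix (Fin 3) (Fin 3) (UnitaryGroup.LocalRing L v))) ∧ ∀ ψ : ↥(Subgroup.center (Gqs L v)) →* ℂˣ, Continuous ψ → (∃ hopen : IsOpen (((ψ.comp detZ).ker : Subgroup (Gqs L v)) : Set (Gqs L v)), 𝔇.detG ψ = IrrClass.mk (SmoothIrrep.ofChar (ψ.comp detZ) hopen)) ∧ 𝔇.stG ψ ≠ 𝔇.detG ψ ∧ (∀ c : IrrClass (Gqs L v), c.IsConstituentOf (cmPrincipalSeries L 3 v (cmTorusCharPair L v (halfModulusChar (UnitaryGroup.LocalRing L v) * halfModulusChar (UnitaryGroup.LocalRing L v))⁻¹ (ψ.comp ιZ))) ↔ (c = 𝔇.stG ψ ∨ c = 𝔇.detG ψ)) ∧ (𝔇.stG ψ).IsSquareIntegrable μZ ∧ ¬ (𝔇.detG ψ).IsSquareIntegrable μZ)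
    -- ══ the trace identity, the `St_G(ψ)`-column, and a `d` satisfying socket #20P's consequent ══
    (hPCT : Ch12Sec6.PseudoCoeffTrace 𝔇)
    {ψ : ↥(Subgroup.center (Gqs L v)) →* ℂˣ} (hψ : Continuous ψ)
    (hOrthoSt : ∀ σ : IrrClass (Gqs L v), 𝔇.IsL2 σ → 𝔇.innerG (𝔇.char σ) (𝔇.char (𝔇.stG ψ)) = if σ = 𝔇.stG ψ then 1 else 0)
    (d : IrrClass (Gqs L v) → ℝ)
    (hPL : ∀ f : Gqs L v → ℂ, f ∈ SchwartzBruhat (Gqs L v) → (∀ γ ∈ 𝔇.regG \ 𝔇.ellG, 𝔇.orbInt γ f = 0) →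
      HasSum (fun σ : {σ : IrrClass (Gqs L v) // 𝔇.IsL2 σ} => ((d (σ : IrrClass (Gqs L v)) : ℝ) : ℂ) * (σ : IrrClass (Gqs L v)).smoothTrace 𝔇.μG f) (f 1)) :
    (∃ fG : Gqs L v → ℂ, IsLocSmooth fG ∧ (fG 1).im = 0 ∧ (fG 1).re < 0 ∧
      (∀ γ : Gqs L v, IsRegularElt (γ.val : GL (Fin 3) (UnitaryGroup.LocalRing L v)) →
        IsCompact ((Subgroup.centralizer ({γ} : Set (Gqs L v))) : Set (Gqs L v)) → classOrbitalIntegral mQv fG (ConjClasses.mk γ) = 1) ∧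
      (∀ γ : Gqs L v, IsRegularElt (γ.val : GL (Fin 3) (UnitaryGroup.LocalRing L v)) →
        ¬ IsCompact ((Subgroup.centralizer ({γ} : Set (Gqs L v))) : Set (Gqs L v)) → classOrbitalIntegral mQv fG (ConjClasses.mk γ) = 0)) ∧
    (∀ fG : Gqs L v → ℂ, IsLocSmooth fG → (fG 1).re < 0 →
      (∀ γ : Gqs L v, IsRegularElt (γ.val : GL (Fin 3) (UnitaryGroup.LocalRing L v)) →
        IsCompact ((Subgroup.centralizer ({γ} : Set (Gqs L v))) : Set (Gqs L v)) → classOrbitalIntegral mQv fG (ConjClasses.mk γ) = 1) →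
      (∀ γ : Gqs L v, IsRegularElt (γ.val : GL (Fin 3) (UnitaryGroup.LocalRing L v)) →
        ¬ IsCompact ((Subgroup.centralizer ({γ} : Set (Gqs L v))) : Set (Gqs L v)) → classOrbitalIntegral mQv fG (ConjClasses.mk γ) = 0) →
      ((d (𝔇.stG ψ) : ℝ) : ℂ) = -fG 1 ∧ d (𝔇.stG ψ) = -(fG 1).re ∧ 0 < d (𝔇.stG ψ)) := by
  obtain ⟨ιZ, detZ, hιZ, -, -, -, hall⟩ := eSt
  obtain ⟨⟨hopen, hdet⟩, hne, hJH, hStL2, -⟩ := hall ψ hψ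
  have hL2 : 𝔇.IsL2 (𝔇.stG ψ) := by
    show (𝔇.stG ψ).IsSquareIntegrable 𝔇.μGZ
    rw [hC03]; exact hStL2
  refine ⟨?_, fun fG hfG hre h1 h0 => discretePlancherel_pins_formalDegree_stG L v hns νQv mQv hcanQ 𝔇 hC01 hC04 hC05 hE hchar detZ hopen hdet
    (ψ.comp ιZ) (hψ.comp hιZ) hne hJH hfG hre h1 h0 hL2 hPCT hOrthoSt d hPL⟩
  obtain ⟨fG, hfG, -, -, -, him, hre, h1, h0⟩ := exists_epFunction_G_all L v hns νQv mQv hcanQ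
  exact ⟨fG, hfG, him, hre, h1, h0⟩

/-! ## §3 At an unramified place, with Kottwitz's function displayed: `d(St_G(ψ)) = ν(I)⁻¹ − ν(K₀)⁻¹ − ν(K₁)⁻¹` -/

set_option maxHeartbeats 1600000 in
set_option synthInstance.maxHeartbeats 400000 in
-- statement-level instance-term unification on the CM local carriers + ★ (G3)-EXPLICIT's own budget line
open scoped Classical in
/-- **THE FORMAL DEGREE OF THE STEINBERG REPRESENTATION IS THE EULER–POINCARÉ VALUE, `d(St_G(ψ)) = ν(I)⁻¹ − ν(K₀)⁻¹ − ν(K₁)⁻¹`** (unramified non-split `v`;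
`K₀`, `K₁` the two maximal parahorics through the model `eA`, `I = K₀ ⊓ K₁` the Iwahori, binders of ★ `epFunction_G_explicit` VERBATIM — `hK0 hK1 hI` are `rfl` at the
consumer): for every `d` satisfying socket #20P's consequent at the datum (same trace inputs `hPCT`, `hOrthoSt` as §2).  The right-hand side is Kottwitz's
`−f_G(1)` for the displayed `f_G = ν(K₀)⁻¹𝟙_{K₀} + ν(K₁)⁻¹𝟙_{K₁} − ν(I)⁻¹𝟙_I`. [cite: Kottwitz1988, §2 Theorem 2] [cite: Rogawski1990, §12.7 Lemma 12.7.2 (proof) p. 194; §12.6 p. 187]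
[cite: Waldspurger2003, formule de Plancherel] -/
theorem discretePlancherel_formalDegree_stG_kottwitz
    (hns : ∀ w : PlacesOver L v, IsCMField.complexConj L • w.1 = w.1)
    (hunr : Algebra.IsUnramifiedIn (𝓞 L) v.asIdeal) (w : PlacesOver L v) (hw : IsCMField.complexConj L • w.1 = w.1)
    {ϖ : w.1.adicCompletion L} (hd : HermitianLattice.UnramifiedLocalConjDatum (galAdicCompletionMap (L := L) (IsCMField.complexConj L) hw) ϖ)
    (g₁ : GL (Fin 3) (w.1.adicCompletion L)) (hg₁ : (g₁ : Matrix (Fin 3) (Fin 3) (w.1.adicCompletion L)) = Matrix.diagonal ![(1 : w.1.adicCompletion L), 1, ϖ])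
    (eA : Gqs L v ≃ₜ* ↥(unitaryGroupOfForm (galAdicCompletionMap (L := L) (IsCMField.complexConj L) hw) ((StdForm.antidiagonal 3).over (w.1.adicCompletion L))))
    (heA : ∀ g : Gqs L v,
      ((eA g : ↥(unitaryGroupOfForm (galAdicCompletionMap (L := L) (IsCMField.complexConj L) hw) ((StdForm.antidiagonal 3).over (w.1.adicCompletion L)))) :
          GL (Fin 3) (w.1.adicCompletion L)) =
        ((localNonsplitEquiv (IsCMField.complexConj L) (qsForm L) (IsCMField.complexConj_ne_one L) w hw g :
          ↥(unitaryGroupOfForm (galAdicCompletionMap (L := L) (IsCMField.complexConj L) hw) (placeForm (qsForm L) w.1))) : GL (Fin 3) (w.1.adicCompletion L)))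
    (K0 K1 I : Subgroup (Gqs L v))
    (hK0 : K0 = ((glInt 3 (w.1.adicCompletion L)).subgroupOf
      (unitaryGroupOfForm (galAdicCompletionMap (L := L) (IsCMField.complexConj L) hw) ((StdForm.antidiagonal 3).over (w.1.adicCompletion L)))).comap
        eA.toMulEquiv.toMonoidHom)
    (hK1 : K1 = (((glInt 3 (w.1.adicCompletion L)).map (MulAut.conj g₁).toMonoidHom).subgroupOf
      (unitaryGroupOfForm (galAdicCompletionMap (L := L) (IsCMField.complexConj L) hw) ((StdForm.antidiagonal 3).over (w.1.adicCompletion L)))).comap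
        eA.toMulEquiv.toMonoidHom)
    (hI : I = K0 ⊓ K1)
    [MeasurableSpace (Gqs L v)] [BorelSpace (Gqs L v)]
    [∀ γ : Gqs L v, MeasurableSpace (Gqs L v ⧸ Subgroup.centralizer ({γ} : Set (Gqs L v)))]
    [∀ γ : Gqs L v, BorelSpace (Gqs L v ⧸ Subgroup.centralizer ({γ} : Set (Gqs L v)))]
    [MeasurableSpace (Gqs L v ⧸ Subgroup.center (Gqs L v))]
    {H : Type} [Group H] [TopologicalSpace H] [IsTopologicalGroup H] [MeasurableSpace H]
    (νQv : Measure (Gqs L v)) [νQv.IsHaarMeasure] [νQv.IsMulRightInvariant] (mQv : OrbitalMeasureFamily (Gqs L v))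
    (hcanQ : mQv.IsCanonical (fun γ => IsRegularElt (γ.val : GL (Fin 3) (UnitaryGroup.LocalRing L v))) νQv)
    (𝔇 : EllipticData (Gqs L v) H) (hC01 : 𝔇.μG = νQv) (hC04 : 𝔇.orb = mQv)
    (hC05 : ∀ γ : Gqs L v, γ ∈ 𝔇.regG ↔ IsRegularElt (γ.val : GL (Fin 3) (UnitaryGroup.LocalRing L v)))
    (hE : ∀ γ : Gqs L v, γ ∈ 𝔇.ellG ↔ IsRegularElt (γ.val : GL (Fin 3) (UnitaryGroup.LocalRing L v)) ∧ γ ∉ hyperbolicSet L v)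
    (hchar : ∀ π : IrrClass (Gqs L v), Measurable (𝔇.char π) ∧ LocallyIntegrable (𝔇.char π) 𝔇.μG ∧
      (∀ x ∈ 𝔇.regG, ∀ᶠ y in 𝓝 x, 𝔇.char π y = 𝔇.char π x) ∧
      ∀ φ : Gqs L v → ℂ, IsLocSmooth φ → π.smoothTrace 𝔇.μG φ = ∫ x, φ x * 𝔇.char π x ∂𝔇.μG)
    {ψ : ↥(Subgroup.center (Gqs L v)) →* ℂˣ} (detZ : Gqs L v →* ↥(Subgroup.center (Gqs L v)))
    (hopen : IsOpen (((ψ.comp detZ).ker : Subgroup (Gqs L v)) : Set (Gqs L v)))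
    (hdet : 𝔇.detG ψ = IrrClass.mk (SmoothIrrep.ofChar (ψ.comp detZ) hopen))
    (ψ₀ : ↥(normOneUnits (conjLocal L (IsCMField.complexConj L) v)) →* ℂˣ) (hψ₀ : Continuous ψ₀)
    (hne : 𝔇.stG ψ ≠ 𝔇.detG ψ)
    (hJH : ∀ c : IrrClass (Gqs L v),
      c.IsConstituentOf (cmPrincipalSeries L 3 v (cmTorusCharPair L v
        (halfModulusChar (UnitaryGroup.LocalRing L v) * halfModulusChar (UnitaryGroup.LocalRing L v))⁻¹ ψ₀)) ↔ (c = 𝔇.stG ψ ∨ c = 𝔇.detG ψ))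
    (hL2 : 𝔇.IsL2 (𝔇.stG ψ))
    (hPCT : Ch12Sec6.PseudoCoeffTrace 𝔇)
    (hOrthoSt : ∀ σ : IrrClass (Gqs L v), 𝔇.IsL2 σ → 𝔇.innerG (𝔇.char σ) (𝔇.char (𝔇.stG ψ)) = if σ = 𝔇.stG ψ then 1 else 0)
    (d : IrrClass (Gqs L v) → ℝ)
    (hPL : ∀ f : Gqs L v → ℂ, f ∈ SchwartzBruhat (Gqs L v) → (∀ γ ∈ 𝔇.regG \ 𝔇.ellG, 𝔇.orbInt γ f = 0) →
      HasSum (fun σ : {σ : IrrClass (Gqs L v) // 𝔇.IsL2 σ} => ((d (σ : IrrClass (Gqs L v)) : ℝ) : ℂ) * (σ : IrrClass (Gqs L v)).smoothTrace 𝔇.μG f) (f 1)) :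
    d (𝔇.stG ψ) = ((νQv I).toReal)⁻¹ - ((νQv K0).toReal)⁻¹ - ((νQv K1).toReal)⁻¹ := by
  -- Kottwitz's function with its clauses (★ (G3)-EXPLICIT)
  set fG : Gqs L v → ℂ := fun g => (((νQv K0).toReal : ℂ))⁻¹ * (K0 : Set (Gqs L v)).indicator (fun _ => (1 : ℂ)) g +
      (((νQv K1).toReal : ℂ))⁻¹ * (K1 : Set (Gqs L v)).indicator (fun _ => (1 : ℂ)) g -
      (((νQv I).toReal : ℂ))⁻¹ * (I : Set (Gqs L v)).indicator (fun _ => (1 : ℂ)) g with hfGdef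
  obtain ⟨hfG, -, -, -, -, hre, h1, h0⟩ :=
    epFunction_G_explicit L v hns hunr w hw hd g₁ hg₁ eA heA K0 K1 I hK0 hK1 hI νQv hcanQ fG hfGdef
  obtain ⟨-, hR, -⟩ := discretePlancherel_pins_formalDegree_stG L v hns νQv mQv hcanQ 𝔇 hC01 hC04 hC05 hE hchar detZ hopen hdet ψ₀ hψ₀ hne hJH
    hfG hre h1 h0 hL2 hPCT hOrthoSt d hPL
  -- `f_G(1) = ν(K₀)⁻¹ + ν(K₁)⁻¹ − ν(I)⁻¹` (`1` lies in the three subgroups)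
  have h1K0 : (K0 : Set (Gqs L v)).indicator (fun _ => (1 : ℂ)) 1 = 1 := Set.indicator_of_mem K0.one_mem _
  have h1K1 : (K1 : Set (Gqs L v)).indicator (fun _ => (1 : ℂ)) 1 = 1 := Set.indicator_of_mem K1.one_mem _
  have h1I : (I : Set (Gqs L v)).indicator (fun _ => (1 : ℂ)) 1 = 1 := Set.indicator_of_mem I.one_mem _
  have hfG1 : fG 1 = (((νQv K0).toReal : ℂ))⁻¹ + (((νQv K1).toReal : ℂ))⁻¹ - (((νQv I).toReal : ℂ))⁻¹ := by
    simp only [hfGdef, h1K0, h1K1, h1I, mul_one]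
  rw [hR, hfG1]
  simp only [Complex.sub_re, Complex.add_re, ← Complex.ofReal_inv, Complex.ofReal_re]
  ring

end CM

end Summit.HodgeConjecture.HodgeConjecture.Cruxes.H413.K2E3DiscretePlancherelPinsSteinberg

end
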